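/-
COR-CM (cell pub-hodgecm2, stage 2 of the Hodge ladder) — count-neutral KERNEL COMBINATORICS «the sheared dihedral family», part XII: the orbit span
and the value module of the slice column (seat prover-pub-hodgecm2-b23-g52-0, binder prover b23, gen 52; claim «SYLOW TRANSFER XII + THE SHEARED DIHEDRAL
FAMILY», HOME/INBOX.md l.23708).  PORT of gen 44ʼs `Census/QuarticInversionOrbit.lean` with `translS` for `translT`: bookkeeping definitions with bodies
(`orbSpanS`, `valModS`) + theorems, on parts V/VI/XI (`…Model`, `…Equivariance`, `…Values`) and gen 44ʼs parts IX–XIV (`Avec`, `binVec`, `mixFace`,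
`sqFace`, `Avec_mixFace`, `Avec_cross`, `memT/memS/memJ`) BY NAME; no `decide` beyond `Bool`/`Fin 4` literals, no certificate, no named fact, no
`sorry`.  `Interfaces.lean` (C1), every E term, B01, `Transposition/*`, `PortJoin/*`, `D2Bridge/*` untouched.
HONEST FRAMING: `HC_CM` is NOT proved, here or anywhere in the tree; nothing here is a period, a count of record or a headline.
-/
import Summits.HodgeConjecture.CorCM.Census.ShearedDihedralValues
import Summits.HodgeConjecture.CorCM.Census.QuarticInversionOrbit

/-!
# The sheared dihedral family, XII: the orbit span `orbSpanS F` (stable under `translH₄`, `translY ζ`, `translS`) and its value module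

gen 44ʼs part XIII with the motion of the involution `s` in place of `t`: **`orbSpanS ζ F`** = the least submodule containing `F` and stable under
`translH₄ g`, `translY ζ`, `translS` (the `ℤ[X_n]`-span of `F` for `ζ = 0`); it lies in `hodge₄` when `F` does (`orbSpanS_le_hodge₄`); **`valModS`** =
its value vectors.  Moves of slot binomials inside the value module: every slot (`slot_memS`), by `y` off/on its mask (`Y_memS`, `Y_memS'`), by `s`
off/on the mask `bS = {1,3}` with the pattern map `qS` (**`S_mem`**, **`S_mem'`**); the two sources of binomials (`mix_memS`, `cross_memS`, via gen 44ʼs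
`Avec_mixFace`, `Avec_cross`).  The spanning trees (gen 44ʼs part XVII) must be re-found for the mask `{1,3}` — successor work
(`HOME/pub-hodgecm2-b23/SHEARED-DIHEDRAL.md` §3b).  All [folklore].

## References
* [Pohlmann1968] H. Pohlmann, Algebraic cycles on abelian varieties of complex multiplication type, Ann. of Math. 88 (1968), Thm 1.
-/

namespace Summit.HodgeConjecture.CorCM.Census.ShearedDihedral

open Summit.HodgeConjecture.CorCM.Census.QuarticInversion

open Finset
open Summit.HodgeConjecture.CorCM.Census.OddSliceFacesModel

noncomputable section

variable (A : Type) [AddCommGroup A] [Fintype A] [DecidableEq A] (ζ : ZMod 2)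

/-! ## §1 The orbit span and the value module -/

/-- **The orbit span of `F`**: the least submodule containing `F` and stable under `translH₄ g`, `translY ζ`, `translS`. [folklore] -/
def orbSpanS (F : Set (Ty₄ A → ℤ)) : Submodule ℤ (Ty₄ A → ℤ) :=
  sInf {N | F ⊆ N ∧ (∀ g : ZMod 2 × A, ∀ v ∈ N, translH₄ A g v ∈ N) ∧ (∀ v ∈ N, translY A ζ v ∈ N) ∧ (∀ v ∈ N, translS A v ∈ N)}

omit [Fintype A] [DecidableEq A] in
/-- `F ⊆ orbSpanS F`. [folklore] -/
theorem subset_orbSpanS (F : Set (Ty₄ A → ℤ)) {f : Ty₄ A → ℤ} (hf : f ∈ F) : f ∈ orbSpanS A ζ F := by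
  rw [orbSpanS, Submodule.mem_sInf]
  intro N hN
  exact hN.1 hf

omit [Fintype A] [DecidableEq A] in
/-- The orbit span is stable under `H₀`. [folklore] -/
theorem translH₄_mem_orbSpanS (F : Set (Ty₄ A → ℤ)) (g : ZMod 2 × A) {v : Ty₄ A → ℤ} (hv : v ∈ orbSpanS A ζ F) :
    translH₄ A g v ∈ orbSpanS A ζ F := by
  rw [orbSpanS, Submodule.mem_sInf] at hv ⊢
  intro N hN
  exact hN.2.1 g v (hv N hN)

omit [Fintype A] [DecidableEq A] in
/-- The orbit span is stable under `y`. [folklore] -/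
theorem translY_mem_orbSpanS (F : Set (Ty₄ A → ℤ)) {v : Ty₄ A → ℤ} (hv : v ∈ orbSpanS A ζ F) : translY A ζ v ∈ orbSpanS A ζ F := by
  rw [orbSpanS, Submodule.mem_sInf] at hv ⊢
  intro N hN
  exact hN.2.2.1 v (hv N hN)

omit [Fintype A] [DecidableEq A] in
/-- The orbit span is stable under `t`. [folklore] -/
theorem translS_mem_orbSpanS (F : Set (Ty₄ A → ℤ)) {v : Ty₄ A → ℤ} (hv : v ∈ orbSpanS A ζ F) : translS A v ∈ orbSpanS A ζ F := by
  rw [orbSpanS, Submodule.mem_sInf] at hv ⊢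
  intro N hN
  exact hN.2.2.2 v (hv N hN)

omit [Fintype A] [DecidableEq A] in
/-- **Induction**: a stable submodule containing `F` contains the orbit span. [folklore] -/
theorem orbSpanS_le {F : Set (Ty₄ A → ℤ)} {N : Submodule ℤ (Ty₄ A → ℤ)} (hF : F ⊆ N) (hH : ∀ g : ZMod 2 × A, ∀ v ∈ N, translH₄ A g v ∈ N)
    (hY : ∀ v ∈ N, translY A ζ v ∈ N) (hT : ∀ v ∈ N, translS A v ∈ N) : orbSpanS A ζ F ≤ N :=
  sInf_le ⟨hF, hH, hY, hT⟩

/-- The orbit span of a family of Hodge vectors lies in `hodge₄`. [folklore] -/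
theorem orbSpanS_le_hodge₄ {F : Set (Ty₄ A → ℤ)} (hF : F ⊆ hodge₄ A) : orbSpanS A ζ F ≤ hodge₄ A :=
  orbSpanS_le A ζ hF (fun g _ hv => translH₄_mem A hv g) (fun _ hv => translY_mem A ζ hv) (fun _ hv => translS_mem A hv)

/-- **The value module** of `F`: the value vectors of the orbit span. [folklore] -/
def valModS (F : Set (Ty₄ A → ℤ)) : Submodule ℤ (Idx A → ℤ) := (orbSpanS A ζ F).map (Avec A)

/-- Value vectors of members of the orbit span lie in the value module. [folklore] -/
theorem Avec_mem_valModS (F : Set (Ty₄ A → ℤ)) {v : Ty₄ A → ℤ} (hv : v ∈ orbSpanS A ζ F) : Avec A v ∈ valModS A ζ F :=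
  Submodule.mem_map_of_mem hv

/-! ## §2 Moving binomials inside the value module -/

variable {ζ}

/-- **Every slot**: a binomial in the value module is there at every slot. [folklore] -/
theorem slot_memS (hA : Odd (Fintype.card A)) {F : Set (Ty₄ A → ℤ)} {j : Fin 4} {h h' : Fin 4 → Bool} {u : A}
    (H : binVec A j h h' u ∈ valModS A ζ F) (u' : A) : binVec A j h h' u' ∈ valModS A ζ F := by
  obtain ⟨c, hc, e⟩ := Submodule.mem_map.mp H
  refine Submodule.mem_map.mpr ⟨translH₄ A (0, u - u') c, translH₄_mem_orbSpanS A ζ F _ hc, ?_⟩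
  rw [Avec_translH₄_of_binVec A hA (u - u') e, sub_sub_cancel]

/-- **Moved by `y`, off the mask.** [folklore] -/
theorem Y_memS (hA : Odd (Fintype.card A)) {F : Set (Ty₄ A → ℤ)} {j j' : Fin 4} {h h' g g' : Fin 4 → Bool} {u : A}
    (hb : bY ζ (σY j) = false) (ej : σY j = j') (e1 : qY ζ h = g) (e2 : qY ζ h' = g') (H : binVec A j h h' u ∈ valModS A ζ F) (u' : A) :
    binVec A j' g g' u' ∈ valModS A ζ F := by
  obtain ⟨c, hc, e⟩ := Submodule.mem_map.mp H
  have hy : Avec A (translY A ζ c) = binVec A j' g g' (-u) := by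
    rw [Avec_translY_of_binVec A hA ζ e, hb]; simp only [Bool.false_eq_true, if_false, ej, e1, e2]
  exact slot_memS A hA (Submodule.mem_map.mpr ⟨translY A ζ c, translY_mem_orbSpanS A ζ F hc, hy⟩) u'

/-- **Moved by `y`, on the mask** (patterns complemented and swapped). [folklore] -/
theorem Y_memS' (hA : Odd (Fintype.card A)) {F : Set (Ty₄ A → ℤ)} {j j' : Fin 4} {h h' g g' : Fin 4 → Bool} {u : A}
    (hb : bY ζ (σY j) = true) (ej : σY j = j') (e1 : qY ζ (fun n => !h' n) = g) (e2 : qY ζ (fun n => !h n) = g')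
    (H : binVec A j h h' u ∈ valModS A ζ F) (u' : A) : binVec A j' g g' u' ∈ valModS A ζ F := by
  obtain ⟨c, hc, e⟩ := Submodule.mem_map.mp H
  have hy : Avec A (translY A ζ c) = binVec A j' g g' (-u) := by
    rw [Avec_translY_of_binVec A hA ζ e, hb]; simp only [if_true, ej, e1, e2]
  exact slot_memS A hA (Submodule.mem_map.mpr ⟨translY A ζ c, translY_mem_orbSpanS A ζ F hc, hy⟩) u'

/-- **Moved by `t`, off the mask.** [folklore] -/
theorem S_mem (hA : Odd (Fintype.card A)) {F : Set (Ty₄ A → ℤ)} {j j' : Fin 4} {h h' g g' : Fin 4 → Bool} {u : A}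
    (hb : bS (σT j) = false) (ej : σT j = j') (e1 : qS h = g) (e2 : qS h' = g') (H : binVec A j h h' u ∈ valModS A ζ F) (u' : A) :
    binVec A j' g g' u' ∈ valModS A ζ F := by
  obtain ⟨c, hc, e⟩ := Submodule.mem_map.mp H
  have ht : Avec A (translS A c) = binVec A j' g g' u := by
    rw [Avec_translS_of_binVec A hA e, hb]; simp only [Bool.false_eq_true, if_false, ej, e1, e2]
  exact slot_memS A hA (Submodule.mem_map.mpr ⟨translS A c, translS_mem_orbSpanS A ζ F hc, ht⟩) u'

/-- **Moved by `t`, on the mask.** [folklore] -/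
theorem S_mem' (hA : Odd (Fintype.card A)) {F : Set (Ty₄ A → ℤ)} {j j' : Fin 4} {h h' g g' : Fin 4 → Bool} {u : A}
    (hb : bS (σT j) = true) (ej : σT j = j') (e1 : qS (fun n => !h' n) = g) (e2 : qS (fun n => !h n) = g')
    (H : binVec A j h h' u ∈ valModS A ζ F) (u' : A) : binVec A j' g g' u' ∈ valModS A ζ F := by
  obtain ⟨c, hc, e⟩ := Submodule.mem_map.mp H
  have ht : Avec A (translS A c) = binVec A j' g g' u := by
    rw [Avec_translS_of_binVec A hA e, hb]; simp only [if_true, ej, e1, e2]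
  exact slot_memS A hA (Submodule.mem_map.mpr ⟨translS A c, translS_mem_orbSpanS A ζ F hc, ht⟩) u'

/-! ## §3 The two sources of binomials -/

/-- **Mixed faces of the family give binomials at every slot** (patterns supplied as literals via `e1`, `e2`). [folklore] -/
theorem mix_memS (hA : Odd (Fintype.card A)) (h3 : 3 ≤ Fintype.card A) {F : Set (Ty₄ A → ℤ)} {Q : Finset A} {w : A} (hw : w ∉ Q)
    (hQ : Q.card = Fintype.card A / 2) {i : Fin 4} (hi : i ≠ 0) {u : A} {b : Fin 4 → Bool} (hb : b i = true)
    (hF : mixFace A Q w i u b ∈ F) {g g' : Fin 4 → Bool} (e1 : (fun n => if n = 0 then false else !b n) = g)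
    (e2 : (fun n => if n = 0 then true else !b n) = g') (u' : A) : binVec A i g g' u' ∈ valModS A ζ F := by
  have h := Avec_mem_valModS A ζ F (subset_orbSpanS A ζ F hF)
  rw [Avec_mixFace A hA h3 hw hQ hi u hb, e1, e2] at h
  exact slot_memS A hA h u'

/-- **The antipodal binomials of coordinate `0` at every slot**, from a complementary pair `S_b, S_{!b}` of the family and a cross datum. [folklore] -/
theorem cross_memS (hA : Odd (Fintype.card A)) {F : Set (Ty₄ A → ℤ)} {P : Finset A} {u₁ u₂ : A} (h1 : u₁ ∉ P) (h2 : u₂ ∉ P)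
    (h12 : u₁ ≠ u₂) (hP : P.card + 1 = Fintype.card A / 2) {σ s₀ : A} (hs₀ : s₀ ∈ insert u₁ (insert u₂ P))
    (hX : ∀ s, s + σ ∈ insert u₁ (insert u₂ P) ↔ (s ∉ insert u₁ (insert u₂ P) ∨ s = s₀)) {b : Fin 4 → Bool}
    (hb : sqFace A P u₁ u₂ b ∈ F) (hb' : sqFace A P u₁ u₂ (fun n => !b n) ∈ F) {g : Fin 4 → Bool} (e1 : (fun n => !b n) = g)
    (u' : A) : binVec A 0 g b u' ∈ valModS A ζ F := by
  have hdiff : sqFace A P u₁ u₂ b - translH₄ A (0, σ) (sqFace A P u₁ u₂ (fun n => !b n)) ∈ orbSpanS A ζ F :=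
    Submodule.sub_mem _ (subset_orbSpanS A ζ F hb) (translH₄_mem_orbSpanS A ζ F _ (subset_orbSpanS A ζ F hb'))
  have h := Avec_mem_valModS A ζ F hdiff
  rw [map_sub, Avec_cross A hA h1 h2 h12 hP hs₀ hX, e1] at h
  exact slot_memS A hA h u'

end

end Summit.HodgeConjecture.CorCM.Census.ShearedDihedral
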